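import Summits.HubbardSuperconductivity.HubbardSuperconductivity.Theses.WeakCouplingBCS
import Summits.HubbardSuperconductivity.HubbardSuperconductivity.Theorems.WeakCouplingBCSWcbcsBcsConstructionInteractionComparison
import Literature.MathematicalPhysics.QuantumLattice.FreeFermiGasNoDWaveOrder
import HarnessLib

/-!
# Negative knowledge for the crux `WcbcsBcsConstruction` (item stmt-HubbardSuperconductivity-2010):
# a weak-coupling ceiling for the `d`-wave order parameter that is UNIFORM in `μ`, and the floors it refutes

Refuter file (D-0016 negative lane, `--supports stmt-HubbardSuperconductivity-2010`), cdisprove seat, cycle 2.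
No Theses decl is asserted.

The crux (route `WeakCouplingBCS`) asserts `∃ δ ∃ U₀ ∃ C ∀ U ∈ (0,U₀) ∃ μ, density-matched ∧
e^{-C/U²} ≤ dWaveOrderParameter U μ`, with `μ` existential and UNLOCALISED (`μ : ℝ`). A window ceiling
`dWaveOrderParameter U μ ≤ C√U(1 + log(1/U))` on compact `[μ₁, μ₂] ⊂ (-4, 0)` is landed
(`stub_orderParameterCeiling`, `…OrderParameterCeiling.lean`); to speak to the crux's bare `∃ μ` one needs a bound
with NO hypothesis on `μ` (the van Hove level `μ = 0`, the band edges and `μ` outside the band included). This file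
proves one, cheaply, from the cycle-2 Literature landing `FreeFermiGasNoDWaveOrder.lean` (free BdG pair-block lower
bound + Fermi-sea trial state + the uniform shell count `#{k : |ε_L(k) - μ| ≤ η} ≤ √η L² + 2L`, valid for EVERY `μ`)
and the interaction comparison `stub_interactionComparison`:

* `dWaveSourceDensity_zero_coupling_le`: the FREE stair `D_L(0, μ, h) ≤ 4√2 √η + 8√2/L + 32 h/η` (`L ≥ 3`, any
  `η > 0`, any `μ`);
* `dWaveOrderParameter_le_free_stair`: `dWaveOrderParameter U μ ≤ 4√2 √η + 32(h + r)/η + U/(2r)` for all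
  `h, r, η > 0`, `U ≥ 0`, `μ ∈ ℝ`;
* `dWaveOrderParameter_le_uniformCeiling`: **`dWaveOrderParameter U μ ≤ 71 · U^{1/4}` for every `U ≥ 0` and
  every `μ ∈ ℝ`** (`η = √U`, `h = r = U^{3/4}`); hence `dWaveOrderParameter U μ → 0` as `U ↓ 0` uniformly in `μ`
  (`dWaveOrderParameter_lt_of_lt_uniform`);
* REFUTED STRENGTHENINGS of the crux (natural "make the floor bigger" variants; all false with NO appeal to density
  matching): a `U`-independent floor `c ≤ dWaveOrderParameter U μ(U)` (`not_exists_constFloor`,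
  `wcbcsBcsConstruction_false_with_constFloor`) and a root floor `c·U^{1/8} ≤ dWaveOrderParameter U μ(U)`
  (`not_exists_eighthRootFloor`): any admissible floor `f(U)` must satisfy `f(U) ≤ 71 U^{1/4}` eventually — the
  crux's `e^{-C/U²}` does, with astronomically much room (the printed Kohn–Luttinger scale; RaghuKivelsonScalapino2010).

READING for provers: the order parameter the crux wants is squeezed into `[e^{-C/U²}, 71 U^{1/4}]` (and
`O(√U log(1/U))` on doping windows); every stair `h ≫ U^{3/4}` of the staircase
`dWaveOrderParameter U μ = ⨅_{h>0} liminf_L D_{L+1}(U, μ, h)` is free-gas physics and carries no information about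
pairing — the constructive content is entirely on the bottom stairs `h ≲ U^{3/4}` (indeed `h ≲ e^{-C/U²}`).
-/

set_option linter.dupNamespace false

noncomputable section

namespace Summit.HubbardSuperconductivity.HubbardSuperconductivity.Theorems.WcbcsBcsConstruction.Negative

open Literature.MathematicalPhysics.QuantumLattice Literature.Probability.LatticeModels Matrix Filter
open scoped Matrix.Norms.L2Operator ComplexOrder Topology

/-! ## §1 The free stair, uniformly in `μ` -/

/-- **The free stair, for every `μ`.** For `L ≥ 3`, `h > 0` and any `η > 0`,
`D_L(0, μ, h) ≤ 4√2 √η + 8√2/L + 32 h/η`: supergradient sandwich `2hL²·D_L(0,μ,h) ≤ E(h) - E(2h) ≤ E(0) - E(2h)`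
and the free sourced energy gain `E(0) - E(2h) ≤ 8√2 h (√η L² + 2L) + 64 h² L²/η`
(`groundEnergy_gain_dWaveSourceTorus_zero_le`). [cite: KomaTasaki1994, §1] -/
theorem dWaveSourceDensity_zero_coupling_le (L : ℕ) [NeZero L] (hL : 3 ≤ L) (μ : ℝ) {h η : ℝ}
    (hh : 0 < h) (hη : 0 < η) :
    dWaveSourceDensity L 0 μ h ≤
      4 * Real.sqrt 2 * Real.sqrt η + 8 * Real.sqrt 2 / (L : ℝ) + 32 * h / η := by
  have hL0 : (0 : ℝ) < L := by exact_mod_cast Nat.pos_of_ne_zero (NeZero.ne L)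
  have hD := dWaveSourceDensity_le_energyDrop_div (L := L) 0 μ hh
  have hE := groundEnergy_dWaveSourceTorus_le (L := L) 0 μ h
  have hG := groundEnergy_gain_dWaveSourceTorus_zero_le hL μ (2 * h) hη
  rw [abs_of_pos (by positivity : (0 : ℝ) < 2 * h)] at hG
  have h128 : (4 * Real.sqrt 2 * (2 * h)) ^ 2 = 128 * h ^ 2 := by
    rw [show (4 * Real.sqrt 2 * (2 * h)) ^ 2 = 64 * Real.sqrt 2 ^ 2 * h ^ 2 by ring,
      Real.sq_sqrt zero_le_two]
    ring
  rw [h128] at hG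
  have hden : (0 : ℝ) < 2 * h * (L : ℝ) ^ 2 := by positivity
  calc dWaveSourceDensity L 0 μ h
      ≤ ((dWaveSourceTorus L 0 μ h).groundEnergy - (dWaveSourceTorus L 0 μ (2 * h)).groundEnergy) /
          (2 * h * (L : ℝ) ^ 2) := hD
    _ ≤ (4 * Real.sqrt 2 * (2 * h) * (Real.sqrt η * (L : ℝ) ^ 2 + 2 * L) +
          128 * h ^ 2 / (2 * η) * (L : ℝ) ^ 2) / (2 * h * (L : ℝ) ^ 2) := by
        gcongr
        linarith
    _ = 4 * Real.sqrt 2 * Real.sqrt η + 8 * Real.sqrt 2 / (L : ℝ) + 32 * h / η := by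
        field_simp
        ring

/-! ## §2 Every stair of the interacting order parameter is a free stair plus `U/(2r)` -/

/-- **Interacting stair ≤ shifted free stair.** For `0 ≤ U`, `L ≥ 3`, `h, r, η > 0` and every `μ`:
`D_L(U, μ, h) ≤ 4√2 √η + 8√2/L + 32 (h + r)/η + U/(2r)` (`stub_interactionComparison` between couplings
`0 ≤ U` with shift `r`, then §1 at source `h + r`). [cite: KomaTasaki1994, §1] -/
theorem dWaveSourceDensity_le_free_stair (L : ℕ) [NeZero L] (hL : 3 ≤ L) (μ : ℝ) {U h r η : ℝ}
    (hU : 0 ≤ U) (hh : 0 < h) (hr : 0 < r) (hη : 0 < η) :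
    dWaveSourceDensity L U μ h ≤
      4 * Real.sqrt 2 * Real.sqrt η + 8 * Real.sqrt 2 / (L : ℝ) + 32 * (h + r) / η + U / (2 * r) := by
  have h1 := (stub_interactionComparison L 0 U μ h r hU hr).2
  rw [sub_zero] at h1
  have h2 := dWaveSourceDensity_zero_coupling_le L hL μ (by positivity : 0 < h + r) hη
  linarith

/-- **The order parameter under every free stair.** For `0 ≤ U`, every `μ ∈ ℝ` and all `h, r, η > 0`:
`dWaveOrderParameter U μ ≤ 4√2 √η + 32 (h + r)/η + U/(2r)` (`dWaveOrderParameter ≤ liminf_L D_{L+1}(U,μ,h)`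
for every `h > 0`; the `8√2/(L+1)` remainder disappears in the liminf). [cite: KomaTasaki1994, §1] -/
theorem dWaveOrderParameter_le_free_stair (μ : ℝ) {U h r η : ℝ} (hU : 0 ≤ U) (hh : 0 < h) (hr : 0 < r)
    (hη : 0 < η) :
    dWaveOrderParameter U μ ≤ 4 * Real.sqrt 2 * Real.sqrt η + 32 * (h + r) / η + U / (2 * r) := by
  refine (dWaveOrderParameter_le_liminf U μ hh).trans ?_
  refine le_of_forall_pos_le_add fun ε hε => ?_
  refine liminf_le_of_frequently_le (Eventually.frequently ?_)
    (isBoundedUnder_of_eventually_ge (a := 0)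
      (Eventually.of_forall fun L => dWaveSourceDensity_nonneg U μ hh.le))
  obtain ⟨N, hN⟩ := exists_nat_gt (8 * Real.sqrt 2 / ε)
  filter_upwards [eventually_ge_atTop (max N 2)] with L hL
  have hNL : N ≤ L := le_of_max_le_left hL
  have h2L : 2 ≤ L := le_of_max_le_right hL
  have hL3 : 3 ≤ L + 1 := by omega
  have hLpos : (0 : ℝ) < ((L + 1 : ℕ) : ℝ) := by positivity
  have hcast : (8 * Real.sqrt 2 / ε : ℝ) < ((L + 1 : ℕ) : ℝ) :=
    hN.trans_le (by exact_mod_cast Nat.le_succ_of_le hNL)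
  have hrem : 8 * Real.sqrt 2 / ((L + 1 : ℕ) : ℝ) ≤ ε := by
    rw [div_le_iff₀ hLpos]
    rw [div_lt_iff₀ hε] at hcast
    linarith
  have hfin := dWaveSourceDensity_le_free_stair (L + 1) hL3 μ hU hh hr hη
  linarith

/-! ## §3 The uniform ceiling `dWaveOrderParameter U μ ≤ 71 U^{1/4}` -/

/-- **Uniform weak-coupling ceiling for the `d`-wave order parameter.** For every `U ≥ 0` and EVERY `μ ∈ ℝ`,
`dWaveOrderParameter U μ ≤ 71 · U^{1/4}` (written `71 √(√U)`): §2 with `η = √U`, `h = r = U^{3/4}` gives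
`4√2 U^{1/4} + 64 U^{1/4} + U^{1/4}/2 ≤ 71 U^{1/4}`; at `U = 0` the left side is `0`
(`dWaveOrderParameter_zero_coupling_eq_zero`). No window, no density matching, no van Hove exclusion.
[cite: KomaTasaki1994, §1] -/
theorem dWaveOrderParameter_le_uniformCeiling {U : ℝ} (hU : 0 ≤ U) (μ : ℝ) :
    dWaveOrderParameter U μ ≤ 71 * Real.sqrt (Real.sqrt U) := by
  rcases hU.eq_or_lt with hU0 | hU0
  · rw [← hU0, dWaveOrderParameter_zero_coupling_eq_zero]
    positivity
  set q : ℝ := Real.sqrt (Real.sqrt U) with hq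
  have hq0 : 0 < q := Real.sqrt_pos.2 (Real.sqrt_pos.2 hU0)
  have hsq : Real.sqrt U = q * q := (Real.mul_self_sqrt (Real.sqrt_nonneg U)).symm
  have hU' : U = q * q * (q * q) := by rw [← hsq]; exact (Real.mul_self_sqrt hU0.le).symm
  have key := dWaveOrderParameter_le_free_stair μ hU0.le (h := q * q * q) (r := q * q * q) (η := q * q)
    (by positivity) (by positivity) (by positivity)
  have hsqrtη : Real.sqrt (q * q) = q := Real.sqrt_mul_self hq0.le
  have e1 : 32 * (q * q * q + q * q * q) / (q * q) = 64 * q := by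
    field_simp
    ring
  have e2 : U / (2 * (q * q * q)) = q / 2 := by
    rw [hU']
    field_simp
  rw [hsqrtη, e1, e2] at key
  have hs2 : Real.sqrt 2 ≤ 3 / 2 := by
    rw [Real.sqrt_le_left (by norm_num : (0 : ℝ) ≤ 3 / 2)]
    norm_num
  nlinarith [mul_le_mul_of_nonneg_right hs2 hq0.le]

/-- **`dWaveOrderParameter U μ → 0` as `U ↓ 0`, uniformly in `μ`**: for every `ε > 0` there is `U₀ > 0` with
`dWaveOrderParameter U μ < ε` for all `U ∈ [0, U₀)` and all `μ`. [cite: KomaTasaki1994, §1] -/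
theorem dWaveOrderParameter_lt_of_lt_uniform {ε : ℝ} (hε : 0 < ε) :
    ∃ U₀ : ℝ, 0 < U₀ ∧ ∀ U ∈ Set.Ico (0 : ℝ) U₀, ∀ μ : ℝ, dWaveOrderParameter U μ < ε := by
  refine ⟨(ε / 72) ^ 4, by positivity, fun U hU μ => ?_⟩
  have hc : 0 ≤ ε / 72 := by positivity
  have hq : Real.sqrt (Real.sqrt U) ≤ ε / 72 := by
    calc Real.sqrt (Real.sqrt U) ≤ Real.sqrt (Real.sqrt ((ε / 72) ^ 4)) :=
          Real.sqrt_le_sqrt (Real.sqrt_le_sqrt hU.2.le)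
      _ = ε / 72 := by
          rw [show (ε / 72) ^ 4 = ((ε / 72) ^ 2) ^ 2 by ring, Real.sqrt_sq (by positivity),
            Real.sqrt_sq hc]
  have := dWaveOrderParameter_le_uniformCeiling hU.1 μ
  linarith

/-! ## §4 Refuted strengthenings of the crux: the floor must vanish at least like `U^{1/4}` -/

/-- **No `U`-independent floor, at ANY chemical potentials `μ(U)`.** [cite: KomaTasaki1994, §1] -/
theorem not_exists_constFloor :
    ¬ ∃ c : ℝ, 0 < c ∧ ∃ U₀ : ℝ, 0 < U₀ ∧ ∀ U ∈ Set.Ioo (0 : ℝ) U₀, ∃ μ : ℝ,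
      c ≤ dWaveOrderParameter U μ := by
  rintro ⟨c, hc, U₀, hU₀, H⟩
  obtain ⟨U₁, hU₁, hsmall⟩ := dWaveOrderParameter_lt_of_lt_uniform hc
  obtain ⟨μ, hμ⟩ := H (min (U₀ / 2) (U₁ / 2)) ⟨lt_min (by linarith) (by linarith),
    (min_le_left _ _).trans_lt (by linarith)⟩
  have := hsmall (min (U₀ / 2) (U₁ / 2)) ⟨(lt_min (by linarith) (by linarith)).le,
    (min_le_right _ _).trans_lt (by linarith)⟩ μ
  linarith

/-- **No root floor `c · U^{1/8}` either** (any floor `f` needs `f(U) ≤ 71 U^{1/4}` eventually).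
[cite: KomaTasaki1994, §1] -/
theorem not_exists_eighthRootFloor :
    ¬ ∃ c : ℝ, 0 < c ∧ ∃ U₀ : ℝ, 0 < U₀ ∧ ∀ U ∈ Set.Ioo (0 : ℝ) U₀, ∃ μ : ℝ,
      c * Real.sqrt (Real.sqrt (Real.sqrt U)) ≤ dWaveOrderParameter U μ := by
  rintro ⟨c, hc, U₀, hU₀, H⟩
  -- at `U = min (U₀/2) ((c/72)^8)`: `p = U^{1/8} ≤ c/72`, floor `c p`, ceiling `71 p² ≤ 71 (c/72) p < c p`
  set U : ℝ := min (U₀ / 2) ((c / 72) ^ 8) with hUdef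
  have hUpos : 0 < U := lt_min (by linarith) (by positivity)
  have hUlt : U < U₀ := (min_le_left _ _).trans_lt (by linarith)
  obtain ⟨μ, hfloor⟩ := H U ⟨hUpos, hUlt⟩
  have hceil := dWaveOrderParameter_le_uniformCeiling hUpos.le μ
  set p : ℝ := Real.sqrt (Real.sqrt (Real.sqrt U)) with hp
  have hp0 : 0 < p := Real.sqrt_pos.2 (Real.sqrt_pos.2 (Real.sqrt_pos.2 hUpos))
  have hqp : Real.sqrt (Real.sqrt U) = p * p := (Real.mul_self_sqrt (Real.sqrt_nonneg _)).symm
  have hc72 : 0 ≤ c / 72 := by positivity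
  have hple : p ≤ c / 72 := by
    have h8 : U ≤ (c / 72) ^ 8 := min_le_right _ _
    calc p ≤ Real.sqrt (Real.sqrt (Real.sqrt ((c / 72) ^ 8))) :=
          Real.sqrt_le_sqrt (Real.sqrt_le_sqrt (Real.sqrt_le_sqrt h8))
      _ = c / 72 := by
          rw [show (c / 72) ^ 8 = (((c / 72) ^ 2) ^ 2) ^ 2 by ring, Real.sqrt_sq (by positivity),
            Real.sqrt_sq (by positivity), Real.sqrt_sq hc72]
  rw [hqp] at hceil
  -- `c p ≤ 71 p² ≤ 71 (c/72) p`
  have h1 : c * p ≤ 71 * (p * p) := hfloor.trans hceil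
  have h2 : 71 * (p * p) ≤ 71 * (c / 72 * p) := by nlinarith
  nlinarith

/-- **STRENGTHENING "`U`-independent floor" of `WcbcsBcsConstruction` is false**: the crux with `e^{-C/U²}`
replaced by the constant `C` (density clause kept verbatim) fails — the interaction has to create the order from
`dWaveOrderParameter 0 μ = 0`, and can create at most `71 U^{1/4}` of it. [cite: KomaTasaki1994, §1] -/
theorem wcbcsBcsConstruction_false_with_constFloor :
    ¬ ∃ δ ∈ Set.Ioo (0:ℝ) (1 / 2), ∃ U₀ : ℝ, 0 < U₀ ∧ ∃ C : ℝ, 0 < C ∧ ∀ U ∈ Set.Ioo (0:ℝ) U₀, ∃ μ : ℝ,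
      Filter.Tendsto (fun L : ℕ => ((hubbardTorusWith 2 (L + 1) 1 U μ).groundStateFunctional
        totalNumber).re / ((L + 1 : ℕ) : ℝ) ^ 2) Filter.atTop (nhds (1 - δ)) ∧
      C ≤ dWaveOrderParameter U μ := by
  rintro ⟨δ, -, U₀, hU₀, C, hC, H⟩
  exact not_exists_constFloor ⟨C, hC, U₀, hU₀, fun U hU => (H U hU).imp fun μ h => h.2⟩

/-- **STRENGTHENING "closed coupling window" of `WcbcsBcsConstruction` is false**: with `Set.Ico 0 U₀` in place
of `Set.Ioo 0 U₀` the witness `U = 0` kills it at every `μ` — Lean reads `exp(-C/0²) = exp 0 = 1` while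
`dWaveOrderParameter 0 μ = 0` (`FreeFermiGasNoDWaveOrder`). So positivity of `U` is load-bearing, and not only
through Lean's division convention: by `dWaveOrderParameter_lt_of_lt_uniform` the order parameter is CONTINUOUS at
`U = 0⁺` uniformly in `μ`, so no floor bounded away from `0` near `U = 0` survives in any convention. [folklore] -/
theorem wcbcsBcsConstruction_false_with_IcoWindow :
    ¬ ∃ δ ∈ Set.Ioo (0:ℝ) (1 / 2), ∃ U₀ : ℝ, 0 < U₀ ∧ ∃ C : ℝ, 0 < C ∧ ∀ U ∈ Set.Ico (0:ℝ) U₀, ∃ μ : ℝ,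
      Filter.Tendsto (fun L : ℕ => ((hubbardTorusWith 2 (L + 1) 1 U μ).groundStateFunctional
        totalNumber).re / ((L + 1 : ℕ) : ℝ) ^ 2) Filter.atTop (nhds (1 - δ)) ∧
      Real.exp (-C / U ^ 2) ≤ dWaveOrderParameter U μ := by
  rintro ⟨δ, -, U₀, hU₀, C, -, H⟩
  obtain ⟨μ, -, hle⟩ := H 0 ⟨le_rfl, hU₀⟩
  rw [dWaveOrderParameter_zero_coupling_eq_zero] at hle
  exact (Real.exp_pos _).not_ge hle

end Summit.HubbardSuperconductivity.HubbardSuperconductivity.Theorems.WcbcsBcsConstruction.Negative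

end
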